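import Mathlib
import HarnessLib
import Summits.NavierStokesRegularity.NavierStokesRegularity.Theorems.PoloidalWindowRigidity.Negative.DriftProfile

/-!
# Crux `PoloidalWindowRigidity` (K2, stmt-NavierStokesRegularity-19708) — negative side:
# the drifting cellular profile has NO common spatial period (but every slice is periodic)

Negative-side support (refuter seat ns-regularity-refuter1, cell ns-regularity-ideate; D-0081 §C), addendum to
`…Negative.DriftProfile` / `…Negative.ResidueFalseWithClassRates`, written against the announced mechanism «M9»
of seat K2-p2 (HOME/STATUS 20:00:47Z): «spatially periodic profiles are trivial — `v(s, y + ℓ) = v(s, y)` for ONE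
period `ℓ ≠ 0` and ALL `s < 0` ⇒ `v ≡ 0`» (zoom-out: the period shrinks under parabolic rescaling).

* `driftProfile_no_common_period`: the drifting discretely self-similar cellular profile
  `w(t,x) = (−t)^{-1/2} V((−t)^{-1/2}x + log(−t) e₁)` has no common spatial period: for every `ℓ ≠ 0` some slice
  moves under `y ↦ y + ℓ`. (Reason: a common period `ℓ` would make `V` invariant under EVERY real multiple of `ℓ`,
  since the slice `s = −1/c²` sees the period `c ℓ` in the similarity variable.) Hence an exclusion hypothesis of the
  M9 shape `¬ ∃ ℓ ≠ 0, ∀ s < 0, ∀ y, v s (y + ℓ) = v s y` added to S2′/S2″ does NOT remove the rate-sharp witness of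
  `sliceSharpResidue_false_with_classRates_without_mild`.
* `driftProfile_slice_periodic`: every single slice IS periodic, with the parabolically growing period
  `2π (−s)^{1/2} e₀` — so only a SLICE-WISE no-period hypothesis would exclude the witness, and such a hypothesis is
  admissible in the residue only once «one periodic slice ⇒ trivial» is settled in the class (it is not: the period
  `2π(−s)^{1/2}` is invariant under the zoom-out, which is exactly the discretely self-similar regime, BT17 OP 5.1).

WHAT THIS IS NOT: not a claim about Navier–Stokes — kinematics of an explicit profile. [folklore]
-/

noncomputable section

namespace Summit.NavierStokesRegularity.NavierStokesRegularity.Theorems.PoloidalWindowRigidity.Negative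

open Set Function
open scoped RealInnerProductSpace InnerProductSpace
open Literature.Analysis Literature.Analysis.FluidPDE

/-- The slice `s = −1/c²` (`c > 0`) has amplitude `(−s)^{-1/2} = c`. [folklore] -/
theorem cellAmp_neg_inv_sq {c : ℝ} (hc : 0 < c) : cellAmp (-(c ^ 2)⁻¹) = c := by
  rw [cellAmp, neg_neg, Real.sqrt_inv, Real.sqrt_sq hc.le, inv_inv]

/-- A common spatial period `ℓ` of the drifting profile would make the cellular field invariant under every real
multiple of `ℓ`. [folklore] -/
theorem cellField_translate_of_common_period {ℓ : EuclideanSpace ℝ (Fin 3)}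
    (hper : ∀ s < 0, ∀ y : EuclideanSpace ℝ (Fin 3), driftProfile s (y + ℓ) = driftProfile s y) (m : ℝ) :
    cellField (m • ℓ) = cellField 0 := by
  -- positive multiples, at an arbitrary base point
  have pos : ∀ c : ℝ, 0 < c → ∀ z : EuclideanSpace ℝ (Fin 3), cellField (z + c • ℓ) = cellField z := by
    intro c hc z
    have hs : -(c ^ 2)⁻¹ < (0 : ℝ) := by
      have : 0 < (c ^ 2)⁻¹ := by positivity
      linarith
    have hamp := cellAmp_neg_inv_sq hc
    have h := hper _ hs ((cellAmp (-(c ^ 2)⁻¹))⁻¹ •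
      (z - Real.log (-(-(c ^ 2)⁻¹)) • EuclideanSpace.single (1 : Fin 3) (1 : ℝ)))
    unfold driftProfile at h
    rw [← one_smul ℝ ℓ, driftShift_add_smul, driftShift_invPoint hs, hamp, mul_one] at h
    exact smul_right_injective _ hc.ne' h
  rcases lt_trichotomy m 0 with hm | hm | hm
  · -- negative multiple: base point `m • ℓ`, shift by `(-m) • ℓ`
    have h := pos (-m) (by linarith) (m • ℓ)
    rw [← add_smul, add_neg_cancel, zero_smul] at h
    exact h.symm
  · rw [hm, zero_smul]
  · have h := pos m hm 0
    rwa [zero_add] at h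

/-- **The drifting cellular profile has no common spatial period**: for every `ℓ ≠ 0` some slice is moved by the
translation `y ↦ y + ℓ`. [folklore] -/
theorem driftProfile_no_common_period (ℓ : EuclideanSpace ℝ (Fin 3)) (hℓ : ℓ ≠ 0) :
    ∃ s < 0, ∃ y : EuclideanSpace ℝ (Fin 3), driftProfile s (y + ℓ) ≠ driftProfile s y := by
  by_contra hcon
  push Not at hcon
  have key := cellField_translate_of_common_period hcon
  by_cases h2 : ℓ 2 = 0
  · by_cases h0 : ℓ 0 = 0
    · have h1 : ℓ 1 ≠ 0 := by
        intro h1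
        apply hℓ
        ext i
        fin_cases i
        · exact h0
        · exact h1
        · exact h2
      have h := congrArg (fun w : EuclideanSpace ℝ (Fin 3) => w 1) (key (Real.pi / 2 / ℓ 1))
      simp [cellField_apply_one, h2, div_mul_cancel₀ _ h1] at h
    · have h := congrArg (fun w : EuclideanSpace ℝ (Fin 3) => w 0) (key (Real.pi / 2 / ℓ 0))
      simp [cellField_apply_zero, h2, div_mul_cancel₀ _ h0] at h
  · have h := congrArg (fun w : EuclideanSpace ℝ (Fin 3) => w 0) (key (Real.pi / 2 / ℓ 2))
    simp [cellField_apply_zero, div_mul_cancel₀ _ h2] at h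

/-- The M9-shaped exclusion hypothesis «no common spatial period» holds for the drifting profile. [folklore] -/
theorem driftProfile_not_commonPeriodic :
    ¬ ∃ ℓ : EuclideanSpace ℝ (Fin 3), ℓ ≠ 0 ∧
      ∀ s < 0, ∀ y : EuclideanSpace ℝ (Fin 3), driftProfile s (y + ℓ) = driftProfile s y := by
  rintro ⟨ℓ, hℓ, hper⟩
  obtain ⟨s, hs, y, hy⟩ := driftProfile_no_common_period ℓ hℓ
  exact hy (hper s hs y)

/-- The cellular field is `2π`-periodic in `x₀`. [folklore] -/
theorem cellField_add_two_pi_single_zero (z : EuclideanSpace ℝ (Fin 3)) :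
    cellField (z + (2 * Real.pi) • EuclideanSpace.single (0 : Fin 3) (1 : ℝ)) = cellField z := by
  ext i
  fin_cases i
  · simp [cellField_apply_zero, Real.cos_add_two_pi]
  · simp [cellField_apply_one]
  · simp [cellField_apply_two, Real.sin_add_two_pi]

/-- **Every slice of the drifting profile IS spatially periodic**, with the parabolically growing period
`2π(−s)^{1/2} e₀`: `w(s, y + (2π/(−s)^{-1/2}) e₀) = w(s, y)`. [folklore] -/
theorem driftProfile_slice_periodic {s : ℝ} (hs : s < 0) (y : EuclideanSpace ℝ (Fin 3)) :
    driftProfile s (y + (2 * Real.pi / cellAmp s) • EuclideanSpace.single (0 : Fin 3) (1 : ℝ)) =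
      driftProfile s y := by
  have hc := (cellAmp_pos hs).ne'
  have hmul : cellAmp s * (2 * Real.pi / cellAmp s) = 2 * Real.pi := by field_simp
  unfold driftProfile
  rw [driftShift_add_smul, hmul, cellField_add_two_pi_single_zero]

end Summit.NavierStokesRegularity.NavierStokesRegularity.Theorems.PoloidalWindowRigidity.Negative

end
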